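import Summits.QuantumFields.BalabanUV.Beta.GAN24.LegTowerSlavedRows
import Summits.QuantumFields.BalabanUV.Beta.GAN24.TowerRateSlavedSocket

/-!
# `BalabanUV.Beta.GAN24.LegTowerSlavedDriftRows` — binder row G-an2-4 ∕ (CONV-C), W-slot, the (α-0) parity re-cut, row L11 (Q-L): **THE DRIFT TWIN OF THE (Q-L) END
# IN PREDICATE CURRENCY WITH THE SLAVED LONGITUDINAL TERM** — the ONE-STEP DIFFERENCES `Δ_{l+1} − Δ_l` of the right-divergenced leg tower decay GEOMETRICALLY, modulo
# the SAME ruled chain display (H1♮) (at the shifted levels), geometrically decaying window sources (H2d), the first window (H0d), and a geometrically decaying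
# slaved longitudinal amplitude (H3d) (G-an2-4 formalisation swarm, leaf prover `b2b-balaban-gan24-formalise-leaf-03`, gen 67; FILE 4b of the journal INTENT
# [LEAF03-G67-ONLINE] «(Q-L) LETTER ROWS ⟸ THE RULED DISPLAY» — the supplier shape of the DRIFT rows `hL₁' hL₂'` of leaf-01 g73's PART C ∕ D; continues MY FILE 1
# `LegTowerSlavedRows` + FILE 4a `TowerRateSlavedSocket` over leaf-01's `AffineUnroll.diff_succ`)

NOT IN PRINT; OUR BOOKKEEPING ([folklore] window bookkeeping + two lines of real analysis; 0 `def`, 0 cited facts, 0 `def … : Prop`, 0 sorry).  HONEST FRAMING (cell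
contract, verbatim): «discharging `BetaPertH` makes Bałaban's UV stability UNCONDITIONAL — a real constructive-QFT result; it is NOT the continuum limit and NOT the
Clay problem.»  HONEST DEPENDENCY (verbatim): «continuum YM on T⁴ ⇐ BetaPertH ∧ nine spine estimates (0/9 proved); BetaPertH ⇐ (D1) ∧ (D4) ∧ CAP+tail; G-an2-4
gates asym, D1 and NE2/3/4.»

WHAT.
* §1 = MY FILE 4a `TowerRateSlavedSocket` (the abstract window form `window_eq` and the RATE socket `good_tower_rate_of_kfold_slaved`, BY NAME).
* §2 THE DIFFERENCE TOWER OF THE LEG TOWER (g60's objects; `Δ n := fun s ↦ rdiv (T n s)`, `A := legStepB kc K N`, `g m := rdiv ∘ F m`; leaf-01's `diff_succ`):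
  `rdiv_towerDiff_succ` — `Δ_{n+2} − Δ_{n+1} = A (n+1) (Δ_{n+1} − Δ_n) + ((A (n+1) Δ_n − A n Δ_n) + (g (n+1) − g n))` —, `rdiv_towerDiff_window` (its k-window form with the
  SHIFTED maps), **`good_rdiv_towerDiff_of_window_slaved`** — (H1♮) in chain form at every level (the SAME display as FILE 1's: it is used at the shifted levels
  `n+1`), (H2d) on the window's pushed difference sources `(A (m+1) − A m) Δ_m + (g (m+1) − g m)` (the kernel-drift and source-drift letters, NOT split here), (H0d),
  (H3d) ⟹ `∃ c ϑ, … ∀ n, Good (Δ_{n+1} − Δ_n) (c·ϑ^n)`; `…_bdd` (bounded class).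
* §3 `good_rdiv_towerDiff_of_window_slaved_comb` (the dressed comb tower, level-dependent roots), **`locStencil₂_rdiv_towerDiff_of_window_slaved_comb`** (`LocStencil₂`
  currency, fixed root): `∃ c ϑ, 0 ≤ c ∧ 0 < ϑ < 1 ∧ ∀ n, LocStencil₂ (fun s ↦ rdiv (T (n+1) s) − rdiv (T n s)) (c·ϑ^n) δ` — the right-leg DRIFT letter row's shape
  up to sign (FILE 5 turns it into `hL₁' hL₂'` of the parity member).
(H1♮) ∕ (H2d) ∕ (H0d) ∕ (H3d) are DISPLAYED, NOT discharged.  Asserts NO bound on any chain; discharges NOTHING of (Q-L) ∕ (Q-R) ∕ (C) ∕ «T2Shape» ∕ «T2Drift» ∕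
(hW, hWall); 0 wall binders; NEVER «G-an2-4 closed» as (CONV-C); NOT D1, NOT `BetaPertH`, NOT continuum, NOT Clay; not in print.
Unit `b2b-balaban-gan24-formalise-leaf-03` (gen 67), 2026-08-23.
-/

noncomputable section
open Finset
open scoped BigOperators
open Literature.MathematicalPhysics.QuantumFieldTheory
open Literature.MathematicalPhysics.QuantumFieldTheory.Balaban1983to89
open Literature.MathematicalPhysics.QuantumFieldTheory.Balaban1983to89.Beta
open B6BondElimination (unitVec)
open ExpKernelCalculus (MKer Site Decays)
open OneStepResolventKernel (Fib)
open OneStepKernelFamily (colH KInvStep)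
open AffineAveraging (box toSite)
open BalabanCompositeJets (LocStencil₂)
open Summit.QuantumFields.BalabanUV.Beta.KernelWardRelative (gaugeWt)
open Summit.QuantumFields.BalabanUV.Beta.GAN24.T2RecursionAffine (lin4)
open Summit.QuantumFields.BalabanUV.Beta.HessKerDressedUnits (unitK decays_unitK)
open Summit.QuantumFields.BalabanUV.Beta.GAN24.CombesThomas (sfStep smStep)
open Summit.QuantumFields.BalabanUV.Beta.AxialDressingRooted (coDressKBmAt one_le_of_neZero decays_coDressKBmAt_KInvStep)
open Summit.QuantumFields.BalabanUV.Beta.GAN24.Lin4SlotDivergence (hH_unitK_comb)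
open Summit.QuantumFields.BalabanUV.Beta.GAN24.Lin4LegDivergence (hM_unitK_comb)
open Summit.QuantumFields.BalabanUV.Beta.GAN24.Lin4LegTower (rdiv bsum legStep rdiv_lin4_affine)
open Summit.QuantumFields.BalabanUV.Beta.GAN24.Lin4LegTowerUnroll (legStepB bsumPow legChain transport_legStepB_eq bddTab_rdiv bddTab_legStepB legStepB_add)
open Summit.QuantumFields.BalabanUV.Beta.GAN24.AffineUnroll (transport transport_shift mem_of_rec diff_succ)
open Summit.QuantumFields.BalabanUV.Beta.GAN24.T2UnitSplitLevels (bdd₄_zero bdd₄_add bdd₄_sub)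
open Summit.QuantumFields.BalabanUV.Beta.GAN24.WSlotT2OfPieces (locStencil₂_add locStencil₂_mono)
open Summit.QuantumFields.BalabanUV.Beta.GAN24.TowerRateSlavedSocket (window_eq good_tower_rate_of_kfold_slaved)

namespace Summit.QuantumFields.BalabanUV.Beta.GAN24.LegTowerSlavedDriftRows


/-! ## §2 The difference tower of the right-divergenced leg tower -/

section Leg

variable {d : ℕ} {N : ℕ} {kc : ℕ → ℝ} {K : ℕ → MKer (d + 1) (Fib d)}
  {T F : ℕ → (Fin (d + 1) → (Fin (d + 1) → ℤ) → Fin (d + 1) → (Fin (d + 1) → ℤ) → MKer (d + 1) (Fib d))}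

/-- [folklore] The leg tower's one-step law as an identity of tables (g60's `hstep`, `funext`). -/
theorem rdiv_tower_succ_eq
    (hstep : ∀ m κ u κ' u', rdiv (T (m + 1) κ u κ' u')
      = legStep (kc m) (K m) (K m) N (fun κ u κ' u' => bsum N (rdiv (T m κ u κ' u'))) κ u κ' u' + rdiv (F m κ u κ' u')) (m : ℕ) :
    (fun κ u κ' u' => rdiv (T (m + 1) κ u κ' u'))
      = legStepB kc K N m (fun κ u κ' u' => rdiv (T m κ u κ' u')) + fun κ u κ' u' => rdiv (F m κ u κ' u') := by
  funext κ u κ' u'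
  rw [hstep m κ u κ' u']
  rfl

/-- [folklore] **THE DIFFERENCE TOWER's ONE-STEP LAW** (leaf-01's `AffineUnroll.diff_succ` on the bounded class; `Δ n := fun s ↦ rdiv (T n s)`, `A := legStepB kc K N`,
`g m := rdiv ∘ F m`): `Δ_{n+2} − Δ_{n+1} = A (n+1) (Δ_{n+1} − Δ_n) + ((A (n+1) Δ_n − A n Δ_n) + (g (n+1) − g n))` — the SHIFTED map on the previous difference plus
the KERNEL-DRIFT letter read on the previous member plus the SOURCE-DRIFT letter. -/
theorem rdiv_towerDiff_succ (hK : ∀ m, ∃ δ C : ℝ, 0 < δ ∧ Decays (K m) C δ)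
    (hT : ∀ m, ∃ B : ℝ, ∀ κ u κ' u' x z a b, |T m κ u κ' u' x z a b| ≤ B)
    (hstep : ∀ m κ u κ' u', rdiv (T (m + 1) κ u κ' u')
      = legStep (kc m) (K m) (K m) N (fun κ u κ' u' => bsum N (rdiv (T m κ u κ' u'))) κ u κ' u' + rdiv (F m κ u κ' u')) (n : ℕ) :
    (fun κ u κ' u' => rdiv (T (n + 2) κ u κ' u')) - (fun κ u κ' u' => rdiv (T (n + 1) κ u κ' u'))
      = legStepB kc K N (n + 1) ((fun κ u κ' u' => rdiv (T (n + 1) κ u κ' u')) - fun κ u κ' u' => rdiv (T n κ u κ' u'))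
        + ((legStepB kc K N (n + 1) (fun κ u κ' u' => rdiv (T n κ u κ' u')) - legStepB kc K N n (fun κ u κ' u' => rdiv (T n κ u κ' u')))
          + ((fun κ u κ' u' => rdiv (F (n + 1) κ u κ' u')) - fun κ u κ' u' => rdiv (F n κ u κ' u'))) :=
  diff_succ (A := legStepB kc K N) (P := fun W : (Fin (d + 1) → (Fin (d + 1) → ℤ) → Fin (d + 1) → (Fin (d + 1) → ℤ) → MKer (d + 1) (Fib d)) => ∃ B : ℝ, ∀ κ u κ' u' x z a b, |W κ u κ' u' x z a b| ≤ B)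
    (x := fun m => fun κ u κ' u' => rdiv (T m κ u κ' u')) (b := fun m => fun κ u κ' u' => rdiv (F m κ u κ' u'))
    (fun _ _ => bdd₄_sub) (fun j _ _ hX hY => legStepB_add hK j hX hY) (fun j => bddTab_rdiv (hT j)) (rdiv_tower_succ_eq hstep) n

/-- [folklore] **THE k-WINDOW FORM OF THE DIFFERENCE TOWER** (FILE 4a's `window_eq` for the difference tower: SHIFTED maps `A (j+1)`, difference sources; every composite
transport written from level `n+1` by leaf-01's `transport_shift`). -/
theorem rdiv_towerDiff_window (hK : ∀ m, ∃ δ C : ℝ, 0 < δ ∧ Decays (K m) C δ)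
    (hT : ∀ m, ∃ B : ℝ, ∀ κ u κ' u' x z a b, |T m κ u κ' u' x z a b| ≤ B) (hF : ∀ m, ∃ B : ℝ, ∀ κ u κ' u' x z a b, |F m κ u κ' u' x z a b| ≤ B)
    (hstep : ∀ m κ u κ' u', rdiv (T (m + 1) κ u κ' u')
      = legStep (kc m) (K m) (K m) N (fun κ u κ' u' => bsum N (rdiv (T m κ u κ' u'))) κ u κ' u' + rdiv (F m κ u κ' u')) (n k : ℕ) :
    (fun κ u κ' u' => rdiv (T (n + k + 1) κ u κ' u')) - (fun κ u κ' u' => rdiv (T (n + k) κ u κ' u'))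
      = transport (legStepB kc K N) (n + 1) k ((fun κ u κ' u' => rdiv (T (n + 1) κ u κ' u')) - fun κ u κ' u' => rdiv (T n κ u κ' u'))
        + ∑ m ∈ Finset.range k, transport (legStepB kc K N) (n + m + 2) (k - 1 - m)
            ((legStepB kc K N (n + m + 1) (fun κ u κ' u' => rdiv (T (n + m) κ u κ' u')) - legStepB kc K N (n + m) (fun κ u κ' u' => rdiv (T (n + m) κ u κ' u')))
              + ((fun κ u κ' u' => rdiv (F (n + m + 1) κ u κ' u')) - fun κ u κ' u' => rdiv (F (n + m) κ u κ' u'))) := by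
  have h := window_eq (A := fun j => legStepB kc K N (j + 1))
    (P := fun W : (Fin (d + 1) → (Fin (d + 1) → ℤ) → Fin (d + 1) → (Fin (d + 1) → ℤ) → MKer (d + 1) (Fib d)) => ∃ B : ℝ, ∀ κ u κ' u' x z a b, |W κ u κ' u' x z a b| ≤ B)
    (x := fun m => (fun κ u κ' u' => rdiv (T (m + 1) κ u κ' u')) - fun κ u κ' u' => rdiv (T m κ u κ' u'))
    (b := fun m => (legStepB kc K N (m + 1) (fun κ u κ' u' => rdiv (T m κ u κ' u')) - legStepB kc K N m (fun κ u κ' u' => rdiv (T m κ u κ' u')))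
      + ((fun κ u κ' u' => rdiv (F (m + 1) κ u κ' u')) - fun κ u κ' u' => rdiv (F m κ u κ' u')))
    bdd₄_zero (fun _ _ => bdd₄_add) (fun j _ hX => bddTab_legStepB hK (j + 1) hX) (fun j _ _ hX hY => legStepB_add hK (j + 1) hX hY)
    (bdd₄_sub (bddTab_rdiv (hT 1)) (bddTab_rdiv (hT 0)))
    (fun j => bdd₄_add (bdd₄_sub (bddTab_legStepB hK (j + 1) (bddTab_rdiv (hT j))) (bddTab_legStepB hK j (bddTab_rdiv (hT j))))
      (bdd₄_sub (bddTab_rdiv (hF (j + 1))) (bddTab_rdiv (hF j))))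
    (fun j => rdiv_towerDiff_succ hK hT hstep j) n k
  simp only [transport_shift] at h
  convert h using 3

end Leg

section LegEnd

variable {d : ℕ} {N : ℕ} {kc : ℕ → ℝ} {K : ℕ → MKer (d + 1) (Fib d)}
  {T F : ℕ → (Fin (d + 1) → (Fin (d + 1) → ℤ) → Fin (d + 1) → (Fin (d + 1) → ℤ) → MKer (d + 1) (Fib d))}

/-- NOT IN PRINT; OUR BOOKKEEPING.  **THE DRIFT TWIN OF THE (Q-L) END, PREDICATE CURRENCY** (`Δ n := fun s ↦ rdiv (T n s)` under g60's closed one-step law `hstep`;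
class `P` with the rows `hP0` (the first difference), `hPF` (the difference sources), `hPadd`, `hPA` (the step maps on bounded members); `Good` subadditive ∕ monotone;
`GoodL` arbitrary).  IF (H1♮) — THE RULED DISPLAY, VERBATIM AS IN MY FILE 1 (it is used at the shifted levels `n+1`): for every level `n` and bounded `W ∈ P`,
`Good W c → GoodL W g → Good (legChain kc K N n k₀ (fun s ↦ bsumPow N k₀ (W s))) (θ·c + Cg·g)` —, (H2d) the window's pushed DIFFERENCE sources — the kernel-drift
letter `(A (m+1) − A m) Δ_m` plus the source-drift letter `g (m+1) − g m`, transported from level `m+2` — have `Good (…) (s·μ^n)` (`0 ≤ μ < 1`), (H0d) `Good (Δ_{i+1} −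
Δ_i) M` on the first window, (H3d) `GoodL (Δ_{n+1} − Δ_n) (σ·μ^n)` — the slaved longitudinal DRIFT —, THEN `∃ c ϑ, 0 ≤ c ∧ 0 < ϑ < 1 ∧ ∀ n, Good (Δ_{n+1} − Δ_n)
(c·ϑ^n)`.  Nothing of (H1♮) ∕ (H2d) ∕ (H3d) is claimed. -/
theorem good_rdiv_towerDiff_of_window_slaved (hK : ∀ m, ∃ δ C : ℝ, 0 < δ ∧ Decays (K m) C δ)
    (hT : ∀ m, ∃ B : ℝ, ∀ κ u κ' u' x z a b, |T m κ u κ' u' x z a b| ≤ B) (hF : ∀ m, ∃ B : ℝ, ∀ κ u κ' u' x z a b, |F m κ u κ' u' x z a b| ≤ B)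
    (hstep : ∀ m κ u κ' u', rdiv (T (m + 1) κ u κ' u')
      = legStep (kc m) (K m) (K m) N (fun κ u κ' u' => bsum N (rdiv (T m κ u κ' u'))) κ u κ' u' + rdiv (F m κ u κ' u'))
    (P : (Fin (d + 1) → (Fin (d + 1) → ℤ) → Fin (d + 1) → (Fin (d + 1) → ℤ) → MKer (d + 1) (Fib d)) → Prop)
    (hP0 : P ((fun κ u κ' u' => rdiv (T 1 κ u κ' u')) - fun κ u κ' u' => rdiv (T 0 κ u κ' u')))
    (hPF : ∀ m, P ((legStepB kc K N (m + 1) (fun κ u κ' u' => rdiv (T m κ u κ' u')) - legStepB kc K N m (fun κ u κ' u' => rdiv (T m κ u κ' u')))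
      + ((fun κ u κ' u' => rdiv (F (m + 1) κ u κ' u')) - fun κ u κ' u' => rdiv (F m κ u κ' u'))))
    (hPadd : ∀ X Y, P X → P Y → P (X + Y))
    (hPA : ∀ j (W : (Fin (d + 1) → (Fin (d + 1) → ℤ) → Fin (d + 1) → (Fin (d + 1) → ℤ) → MKer (d + 1) (Fib d))), P W →
      (∃ B : ℝ, ∀ κ u κ' u' x z a b, |W κ u κ' u' x z a b| ≤ B) → P (legStepB kc K N j W))
    {Good GoodL : (Fin (d + 1) → (Fin (d + 1) → ℤ) → Fin (d + 1) → (Fin (d + 1) → ℤ) → MKer (d + 1) (Fib d)) → ℝ → Prop}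
    (hGadd : ∀ X Y c c', Good X c → Good Y c' → Good (X + Y) (c + c')) (hGmono : ∀ X c c', c ≤ c' → Good X c → Good X c')
    {k₀ : ℕ} (hk : 0 < k₀) {θ Cg s M σ μ : ℝ} (hθ0 : 0 ≤ θ) (hθ1 : θ < 1) (hCg : 0 ≤ Cg) (hs : 0 ≤ s) (hM : 0 ≤ M) (hσ : 0 ≤ σ)
    (hμ0 : 0 ≤ μ) (hμ1 : μ < 1)
    (H1 : ∀ n (W : (Fin (d + 1) → (Fin (d + 1) → ℤ) → Fin (d + 1) → (Fin (d + 1) → ℤ) → MKer (d + 1) (Fib d))) (c' g : ℝ), P W →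
      (∃ B : ℝ, ∀ κ u κ' u' x z a b, |W κ u κ' u' x z a b| ≤ B) → Good W c' → GoodL W g →
        Good (legChain kc K N n k₀ (fun κ u κ' u' => bsumPow N k₀ (W κ u κ' u'))) (θ * c' + Cg * g))
    (H2 : ∀ n, Good (∑ m ∈ Finset.range k₀, transport (legStepB kc K N) (n + m + 2) (k₀ - 1 - m)
      ((legStepB kc K N (n + m + 1) (fun κ u κ' u' => rdiv (T (n + m) κ u κ' u'))
          - legStepB kc K N (n + m) (fun κ u κ' u' => rdiv (T (n + m) κ u κ' u')))
        + ((fun κ u κ' u' => rdiv (F (n + m + 1) κ u κ' u')) - fun κ u κ' u' => rdiv (F (n + m) κ u κ' u')))) (s * μ ^ n))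
    (H0 : ∀ i, i < k₀ → Good ((fun κ u κ' u' => rdiv (T (i + 1) κ u κ' u')) - fun κ u κ' u' => rdiv (T i κ u κ' u')) M)
    (H3 : ∀ n, GoodL ((fun κ u κ' u' => rdiv (T (n + 1) κ u κ' u')) - fun κ u κ' u' => rdiv (T n κ u κ' u')) (σ * μ ^ n)) :
    ∃ c ϑ : ℝ, 0 ≤ c ∧ 0 < ϑ ∧ ϑ < 1 ∧ ∀ n, Good ((fun κ u κ' u' => rdiv (T (n + 1) κ u κ' u')) - fun κ u κ' u' => rdiv (T n κ u κ' u')) (c * ϑ ^ n) := by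
  -- membership of the differences in `P ∧ bounded` along the difference recursion
  have hD : ∀ n, (P ((fun κ u κ' u' => rdiv (T (n + 1) κ u κ' u')) - fun κ u κ' u' => rdiv (T n κ u κ' u')) ∧
      ∃ B : ℝ, ∀ κ u κ' u' x z a b, |((fun κ u κ' u' => rdiv (T (n + 1) κ u κ' u')) - fun κ u κ' u' => rdiv (T n κ u κ' u')) κ u κ' u' x z a b| ≤ B) :=
    mem_of_rec (A := fun j => legStepB kc K N (j + 1))
      (P := fun W => P W ∧ ∃ B : ℝ, ∀ κ u κ' u' x z a b, |W κ u κ' u' x z a b| ≤ B)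
      (x := fun m => (fun κ u κ' u' => rdiv (T (m + 1) κ u κ' u')) - fun κ u κ' u' => rdiv (T m κ u κ' u'))
      (b := fun m => (legStepB kc K N (m + 1) (fun κ u κ' u' => rdiv (T m κ u κ' u')) - legStepB kc K N m (fun κ u κ' u' => rdiv (T m κ u κ' u')))
        + ((fun κ u κ' u' => rdiv (F (m + 1) κ u κ' u')) - fun κ u κ' u' => rdiv (F m κ u κ' u')))
      (fun _ _ hX hY => ⟨hPadd _ _ hX.1 hY.1, bdd₄_add hX.2 hY.2⟩) (fun j _ hX => ⟨hPA (j + 1) _ hX.1 hX.2, bddTab_legStepB hK (j + 1) hX.2⟩)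
      ⟨hP0, bdd₄_sub (bddTab_rdiv (hT 1)) (bddTab_rdiv (hT 0))⟩
      (fun j => ⟨hPF j, bdd₄_add (bdd₄_sub (bddTab_legStepB hK (j + 1) (bddTab_rdiv (hT j))) (bddTab_legStepB hK j (bddTab_rdiv (hT j))))
        (bdd₄_sub (bddTab_rdiv (hF (j + 1))) (bddTab_rdiv (hF j)))⟩)
      (fun j => rdiv_towerDiff_succ hK hT hstep j)
  refine good_tower_rate_of_kfold_slaved (Good := Good) (GoodL := GoodL)
    (P := fun W => P W ∧ ∃ B : ℝ, ∀ κ u κ' u' x z a b, |W κ u κ' u' x z a b| ≤ B)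
    (x := fun n => (fun κ u κ' u' => rdiv (T (n + 1) κ u κ' u')) - fun κ u κ' u' => rdiv (T n κ u κ' u'))
    (Φ := fun m W => transport (legStepB kc K N) (m + 1) k₀ W)
    (S := fun n => ∑ m ∈ Finset.range k₀, transport (legStepB kc K N) (n + m + 2) (k₀ - 1 - m)
      ((legStepB kc K N (n + m + 1) (fun κ u κ' u' => rdiv (T (n + m) κ u κ' u'))
          - legStepB kc K N (n + m) (fun κ u κ' u' => rdiv (T (n + m) κ u κ' u')))
        + ((fun κ u κ' u' => rdiv (F (n + m + 1) κ u κ' u')) - fun κ u κ' u' => rdiv (F (n + m) κ u κ' u'))))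
    hGadd hGmono hk (fun m => rdiv_towerDiff_window hK hT hF hstep m k₀) hD hθ0 hθ1 hCg hs hM hσ hμ0 hμ1
    (fun m W c' g hW hc hg => ?_) H2 H0 H3
  show Good (transport (legStepB kc K N) (m + 1) k₀ W) (θ * c' + Cg * g)
  rw [transport_legStepB_eq hK (m + 1) k₀ hW.2]
  exact H1 (m + 1) W c' g hW.1 hW.2 hc hg

/-- NOT IN PRINT; OUR BOOKKEEPING.  **THE SAME ON THE BOUNDED CLASS** (`P :=` bounded; its four rows automatic). -/
theorem good_rdiv_towerDiff_of_window_slaved_bdd (hK : ∀ m, ∃ δ C : ℝ, 0 < δ ∧ Decays (K m) C δ)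
    (hT : ∀ m, ∃ B : ℝ, ∀ κ u κ' u' x z a b, |T m κ u κ' u' x z a b| ≤ B) (hF : ∀ m, ∃ B : ℝ, ∀ κ u κ' u' x z a b, |F m κ u κ' u' x z a b| ≤ B)
    (hstep : ∀ m κ u κ' u', rdiv (T (m + 1) κ u κ' u')
      = legStep (kc m) (K m) (K m) N (fun κ u κ' u' => bsum N (rdiv (T m κ u κ' u'))) κ u κ' u' + rdiv (F m κ u κ' u'))
    {Good GoodL : (Fin (d + 1) → (Fin (d + 1) → ℤ) → Fin (d + 1) → (Fin (d + 1) → ℤ) → MKer (d + 1) (Fib d)) → ℝ → Prop}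
    (hGadd : ∀ X Y c c', Good X c → Good Y c' → Good (X + Y) (c + c')) (hGmono : ∀ X c c', c ≤ c' → Good X c → Good X c')
    {k₀ : ℕ} (hk : 0 < k₀) {θ Cg s M σ μ : ℝ} (hθ0 : 0 ≤ θ) (hθ1 : θ < 1) (hCg : 0 ≤ Cg) (hs : 0 ≤ s) (hM : 0 ≤ M) (hσ : 0 ≤ σ)
    (hμ0 : 0 ≤ μ) (hμ1 : μ < 1)
    (H1 : ∀ n (W : (Fin (d + 1) → (Fin (d + 1) → ℤ) → Fin (d + 1) → (Fin (d + 1) → ℤ) → MKer (d + 1) (Fib d))) (c' g : ℝ),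
      (∃ B : ℝ, ∀ κ u κ' u' x z a b, |W κ u κ' u' x z a b| ≤ B) → Good W c' → GoodL W g →
        Good (legChain kc K N n k₀ (fun κ u κ' u' => bsumPow N k₀ (W κ u κ' u'))) (θ * c' + Cg * g))
    (H2 : ∀ n, Good (∑ m ∈ Finset.range k₀, transport (legStepB kc K N) (n + m + 2) (k₀ - 1 - m)
      ((legStepB kc K N (n + m + 1) (fun κ u κ' u' => rdiv (T (n + m) κ u κ' u'))
          - legStepB kc K N (n + m) (fun κ u κ' u' => rdiv (T (n + m) κ u κ' u')))
        + ((fun κ u κ' u' => rdiv (F (n + m + 1) κ u κ' u')) - fun κ u κ' u' => rdiv (F (n + m) κ u κ' u')))) (s * μ ^ n))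
    (H0 : ∀ i, i < k₀ → Good ((fun κ u κ' u' => rdiv (T (i + 1) κ u κ' u')) - fun κ u κ' u' => rdiv (T i κ u κ' u')) M)
    (H3 : ∀ n, GoodL ((fun κ u κ' u' => rdiv (T (n + 1) κ u κ' u')) - fun κ u κ' u' => rdiv (T n κ u κ' u')) (σ * μ ^ n)) :
    ∃ c ϑ : ℝ, 0 ≤ c ∧ 0 < ϑ ∧ ϑ < 1 ∧ ∀ n, Good ((fun κ u κ' u' => rdiv (T (n + 1) κ u κ' u')) - fun κ u κ' u' => rdiv (T n κ u κ' u')) (c * ϑ ^ n) :=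
  good_rdiv_towerDiff_of_window_slaved hK hT hF hstep (fun W => ∃ B : ℝ, ∀ κ u κ' u' x z a b, |W κ u κ' u' x z a b| ≤ B)
    (bdd₄_sub (bddTab_rdiv (hT 1)) (bddTab_rdiv (hT 0)))
    (fun j => bdd₄_add (bdd₄_sub (bddTab_legStepB hK (j + 1) (bddTab_rdiv (hT j))) (bddTab_legStepB hK j (bddTab_rdiv (hT j))))
      (bdd₄_sub (bddTab_rdiv (hF (j + 1))) (bddTab_rdiv (hF j))))
    (fun _ _ hX hY => bdd₄_add hX hY) (fun j _ hW _ => bddTab_legStepB hK j hW)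
    hGadd hGmono hk hθ0 hθ1 hCg hs hM hσ hμ0 hμ1 (fun n W c' g _ hW hc hg => H1 n W c' g hW hc hg) H2 H0 H3

/-- NOT IN PRINT; OUR BOOKKEEPING.  **THE SAME FROM THE AFFINE RECURSION ITSELF** (`T (m+1) = lin4 (c m) (K m) N (T m) + F m`, (hH)∕(hM♯), `N ≥ 1`, `T 0` and the sources
bounded, `kc m = −(c m·cH m)`; class `P` generic). -/
theorem good_rdiv_towerDiff_of_window_slaved_of_rec {c cH : ℕ → ℝ} (hK : ∀ m, ∃ δ C : ℝ, 0 < δ ∧ Decays (K m) C δ) (hN : 1 ≤ N)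
    (hT0 : ∃ B : ℝ, ∀ κ u κ' u' x z a b, |T 0 κ u κ' u' x z a b| ≤ B) (hF : ∀ m, ∃ B : ℝ, ∀ κ u κ' u' x z a b, |F m κ u κ' u' x z a b| ≤ B)
    (hrec : ∀ m, T (m + 1) = lin4 (c m) (K m) N (T m) + F m)
    (hH : ∀ m (y : Site (d + 1)) (κ : Fin (d + 1)) (u : Site (d + 1)),
      ∑ μ, (colH (K m) N μ (y - unitVec μ) κ u - colH (K m) N μ y κ u) = cH m * gaugeWt N y κ u)
    (hMf : ∀ m (y x₂ : Site (d + 1)) (ρ : Fin (d + 1)),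
      ∑ μ, (K m x₂ ((N : ℤ) • (y - unitVec μ)) (Sum.inr ρ) (Sum.inr μ) - K m x₂ ((N : ℤ) • y) (Sum.inr ρ) (Sum.inr μ)) = 0)
    (P : (Fin (d + 1) → (Fin (d + 1) → ℤ) → Fin (d + 1) → (Fin (d + 1) → ℤ) → MKer (d + 1) (Fib d)) → Prop)
    (hP0 : P ((fun κ u κ' u' => rdiv (T 1 κ u κ' u')) - fun κ u κ' u' => rdiv (T 0 κ u κ' u')))
    (hPF : ∀ m, P ((legStepB (fun m => -(c m * cH m)) K N (m + 1) (fun κ u κ' u' => rdiv (T m κ u κ' u'))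
        - legStepB (fun m => -(c m * cH m)) K N m (fun κ u κ' u' => rdiv (T m κ u κ' u')))
      + ((fun κ u κ' u' => rdiv (F (m + 1) κ u κ' u')) - fun κ u κ' u' => rdiv (F m κ u κ' u'))))
    (hPadd : ∀ X Y, P X → P Y → P (X + Y))
    (hPA : ∀ j (W : (Fin (d + 1) → (Fin (d + 1) → ℤ) → Fin (d + 1) → (Fin (d + 1) → ℤ) → MKer (d + 1) (Fib d))), P W →
      (∃ B : ℝ, ∀ κ u κ' u' x z a b, |W κ u κ' u' x z a b| ≤ B) → P (legStepB (fun m => -(c m * cH m)) K N j W))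
    {Good GoodL : (Fin (d + 1) → (Fin (d + 1) → ℤ) → Fin (d + 1) → (Fin (d + 1) → ℤ) → MKer (d + 1) (Fib d)) → ℝ → Prop}
    (hGadd : ∀ X Y c c', Good X c → Good Y c' → Good (X + Y) (c + c')) (hGmono : ∀ X c c', c ≤ c' → Good X c → Good X c')
    {k₀ : ℕ} (hk : 0 < k₀) {θ Cg s M σ μ : ℝ} (hθ0 : 0 ≤ θ) (hθ1 : θ < 1) (hCg : 0 ≤ Cg) (hs : 0 ≤ s) (hM : 0 ≤ M) (hσ : 0 ≤ σ)
    (hμ0 : 0 ≤ μ) (hμ1 : μ < 1)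
    (H1 : ∀ n (W : (Fin (d + 1) → (Fin (d + 1) → ℤ) → Fin (d + 1) → (Fin (d + 1) → ℤ) → MKer (d + 1) (Fib d))) (c' g : ℝ), P W →
      (∃ B : ℝ, ∀ κ u κ' u' x z a b, |W κ u κ' u' x z a b| ≤ B) → Good W c' → GoodL W g →
        Good (legChain (fun m => -(c m * cH m)) K N n k₀ (fun κ u κ' u' => bsumPow N k₀ (W κ u κ' u'))) (θ * c' + Cg * g))
    (H2 : ∀ n, Good (∑ m ∈ Finset.range k₀, transport (legStepB (fun m => -(c m * cH m)) K N) (n + m + 2) (k₀ - 1 - m)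
      ((legStepB (fun m => -(c m * cH m)) K N (n + m + 1) (fun κ u κ' u' => rdiv (T (n + m) κ u κ' u'))
          - legStepB (fun m => -(c m * cH m)) K N (n + m) (fun κ u κ' u' => rdiv (T (n + m) κ u κ' u')))
        + ((fun κ u κ' u' => rdiv (F (n + m + 1) κ u κ' u')) - fun κ u κ' u' => rdiv (F (n + m) κ u κ' u')))) (s * μ ^ n))
    (H0 : ∀ i, i < k₀ → Good ((fun κ u κ' u' => rdiv (T (i + 1) κ u κ' u')) - fun κ u κ' u' => rdiv (T i κ u κ' u')) M)
    (H3 : ∀ n, GoodL ((fun κ u κ' u' => rdiv (T (n + 1) κ u κ' u')) - fun κ u κ' u' => rdiv (T n κ u κ' u')) (σ * μ ^ n)) :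
    ∃ c ϑ : ℝ, 0 ≤ c ∧ 0 < ϑ ∧ ϑ < 1 ∧ ∀ n, Good ((fun κ u κ' u' => rdiv (T (n + 1) κ u κ' u')) - fun κ u κ' u' => rdiv (T n κ u κ' u')) (c * ϑ ^ n) := by
  have hTb : ∀ m, ∃ B : ℝ, ∀ κ u κ' u' x z a b, |T m κ u κ' u' x z a b| ≤ B := by
    intro m
    induction m with
    | zero => exact hT0
    | succ m ih =>
      obtain ⟨δ, C, hδ, hKm⟩ := hK m
      rw [hrec m]
      exact bdd₄_add (Lin4Additive.lin4_bdd hKm hδ (c m) N ih) (hF m)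
  refine good_rdiv_towerDiff_of_window_slaved hK hTb hF (fun m κ u κ' u' => ?_) P hP0 hPF hPadd hPA hGadd hGmono hk hθ0 hθ1 hCg hs hM hσ hμ0 hμ1
    H1 H2 H0 H3
  obtain ⟨δ, C, hδ, hKm⟩ := hK m
  obtain ⟨B, hB⟩ := hTb m
  rw [hrec m]
  exact rdiv_lin4_affine hKm hδ hN (c m) hB (hH m) (hMf m) (F m) κ u κ' u'

end LegEnd

/-! ## §3 The comb ∕ wall instance and the `LocStencil₂` currency -/

section Comb

variable {d : ℕ} {Lc : ℕ} [NeZero Lc]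

/-- NOT IN PRINT; OUR BOOKKEEPING.  **THE DRIFT TWIN FOR THE DRESSED COMB TOWER** `K♮ᴱ_m` (level-dependent in-block roots `r m`, `N = Lc`, `kc m = −(c m·(Lc^{d+1})⁻¹)`). -/
theorem good_rdiv_towerDiff_of_window_slaved_comb {r : ℕ → Fin (d + 1) → ℕ} (hr : ∀ m, r m ∈ box (d + 1) Lc) (c : ℕ → ℝ)
    {T F : ℕ → (Fin (d + 1) → (Fin (d + 1) → ℤ) → Fin (d + 1) → (Fin (d + 1) → ℤ) → MKer (d + 1) (Fib d))}
    (hT0 : ∃ B : ℝ, ∀ κ u κ' u' x z a b, |T 0 κ u κ' u' x z a b| ≤ B) (hF : ∀ m, ∃ B : ℝ, ∀ κ u κ' u' x z a b, |F m κ u κ' u' x z a b| ≤ B)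
    (hrec : ∀ m, T (m + 1) = lin4 (c m) (unitK (sfStep Lc m) (smStep d Lc m) (coDressKBmAt (toSite (r m)) Lc (KInvStep (d := d) Lc m))) Lc (T m) + F m)
    (P : (Fin (d + 1) → (Fin (d + 1) → ℤ) → Fin (d + 1) → (Fin (d + 1) → ℤ) → MKer (d + 1) (Fib d)) → Prop)
    (hP0 : P ((fun κ u κ' u' => rdiv (T 1 κ u κ' u')) - fun κ u κ' u' => rdiv (T 0 κ u κ' u')))
    (hPF : ∀ m, P ((legStepB (fun m => -(c m * ((Lc : ℝ) ^ (d + 1))⁻¹)) (fun m => unitK (sfStep Lc m) (smStep d Lc m) (coDressKBmAt (toSite (r m)) Lc (KInvStep (d := d) Lc m))) Lc (m + 1) (fun κ u κ' u' => rdiv (T m κ u κ' u'))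
        - legStepB (fun m => -(c m * ((Lc : ℝ) ^ (d + 1))⁻¹)) (fun m => unitK (sfStep Lc m) (smStep d Lc m) (coDressKBmAt (toSite (r m)) Lc (KInvStep (d := d) Lc m))) Lc m (fun κ u κ' u' => rdiv (T m κ u κ' u')))
      + ((fun κ u κ' u' => rdiv (F (m + 1) κ u κ' u')) - fun κ u κ' u' => rdiv (F m κ u κ' u'))))
    (hPadd : ∀ X Y, P X → P Y → P (X + Y))
    (hPA : ∀ j (W : (Fin (d + 1) → (Fin (d + 1) → ℤ) → Fin (d + 1) → (Fin (d + 1) → ℤ) → MKer (d + 1) (Fib d))), P W →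
      (∃ B : ℝ, ∀ κ u κ' u' x z a b, |W κ u κ' u' x z a b| ≤ B) → P (legStepB (fun m => -(c m * ((Lc : ℝ) ^ (d + 1))⁻¹)) (fun m => unitK (sfStep Lc m) (smStep d Lc m) (coDressKBmAt (toSite (r m)) Lc (KInvStep (d := d) Lc m))) Lc j W))
    {Good GoodL : (Fin (d + 1) → (Fin (d + 1) → ℤ) → Fin (d + 1) → (Fin (d + 1) → ℤ) → MKer (d + 1) (Fib d)) → ℝ → Prop}
    (hGadd : ∀ X Y c c', Good X c → Good Y c' → Good (X + Y) (c + c')) (hGmono : ∀ X c c', c ≤ c' → Good X c → Good X c')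
    {k₀ : ℕ} (hk : 0 < k₀) {θ Cg s M σ μ : ℝ} (hθ0 : 0 ≤ θ) (hθ1 : θ < 1) (hCg : 0 ≤ Cg) (hs : 0 ≤ s) (hM : 0 ≤ M) (hσ : 0 ≤ σ)
    (hμ0 : 0 ≤ μ) (hμ1 : μ < 1)
    (H1 : ∀ n (W : (Fin (d + 1) → (Fin (d + 1) → ℤ) → Fin (d + 1) → (Fin (d + 1) → ℤ) → MKer (d + 1) (Fib d))) (c' g : ℝ), P W →
      (∃ B : ℝ, ∀ κ u κ' u' x z a b, |W κ u κ' u' x z a b| ≤ B) → Good W c' → GoodL W g →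
        Good (legChain (fun m => -(c m * ((Lc : ℝ) ^ (d + 1))⁻¹)) (fun m => unitK (sfStep Lc m) (smStep d Lc m) (coDressKBmAt (toSite (r m)) Lc (KInvStep (d := d) Lc m))) Lc n k₀ (fun κ u κ' u' => bsumPow Lc k₀ (W κ u κ' u'))) (θ * c' + Cg * g))
    (H2 : ∀ n, Good (∑ m ∈ Finset.range k₀, transport (legStepB (fun m => -(c m * ((Lc : ℝ) ^ (d + 1))⁻¹)) (fun m => unitK (sfStep Lc m) (smStep d Lc m) (coDressKBmAt (toSite (r m)) Lc (KInvStep (d := d) Lc m))) Lc) (n + m + 2) (k₀ - 1 - m)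
      ((legStepB (fun m => -(c m * ((Lc : ℝ) ^ (d + 1))⁻¹)) (fun m => unitK (sfStep Lc m) (smStep d Lc m) (coDressKBmAt (toSite (r m)) Lc (KInvStep (d := d) Lc m))) Lc (n + m + 1) (fun κ u κ' u' => rdiv (T (n + m) κ u κ' u'))
          - legStepB (fun m => -(c m * ((Lc : ℝ) ^ (d + 1))⁻¹)) (fun m => unitK (sfStep Lc m) (smStep d Lc m) (coDressKBmAt (toSite (r m)) Lc (KInvStep (d := d) Lc m))) Lc (n + m) (fun κ u κ' u' => rdiv (T (n + m) κ u κ' u')))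
        + ((fun κ u κ' u' => rdiv (F (n + m + 1) κ u κ' u')) - fun κ u κ' u' => rdiv (F (n + m) κ u κ' u')))) (s * μ ^ n))
    (H0 : ∀ i, i < k₀ → Good ((fun κ u κ' u' => rdiv (T (i + 1) κ u κ' u')) - fun κ u κ' u' => rdiv (T i κ u κ' u')) M)
    (H3 : ∀ n, GoodL ((fun κ u κ' u' => rdiv (T (n + 1) κ u κ' u')) - fun κ u κ' u' => rdiv (T n κ u κ' u')) (σ * μ ^ n)) :
    ∃ c ϑ : ℝ, 0 ≤ c ∧ 0 < ϑ ∧ ϑ < 1 ∧ ∀ n, Good ((fun κ u κ' u' => rdiv (T (n + 1) κ u κ' u')) - fun κ u κ' u' => rdiv (T n κ u κ' u')) (c * ϑ ^ n) := by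
  have hK : ∀ m, ∃ δ C : ℝ, 0 < δ ∧ Decays (unitK (sfStep Lc m) (smStep d Lc m) (coDressKBmAt (toSite (r m)) Lc (KInvStep (d := d) Lc m))) C δ := by
    intro m
    obtain ⟨δK, CK, hδK, -, hG⟩ := decays_coDressKBmAt_KInvStep (d := d) (hr m) m
    exact ⟨δK, _, hδK, decays_unitK hG⟩
  exact good_rdiv_towerDiff_of_window_slaved_of_rec (cH := fun _ => ((Lc : ℝ) ^ (d + 1))⁻¹) hK (one_le_of_neZero Lc) hT0 hF hrec
    (fun m => hH_unitK_comb (hr m) m) (fun m => hM_unitK_comb m) P hP0 hPF hPadd hPA hGadd hGmono hk hθ0 hθ1 hCg hs hM hσ hμ0 hμ1 H1 H2 H0 H3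

/-- NOT IN PRINT; OUR BOOKKEEPING.  **`LocStencil₂` CURRENCY, FIXED ROOT** — the size predicate of the leg DRIFT letter rows: for the dressed comb tower with a fixed in-block
root `r` (the parity member's law): (H1♮)_δ ∧ (H2d)_δ ∧ (H0d)_δ ∧ (H3d) ⟹ `∃ c ϑ, 0 ≤ c ∧ 0 < ϑ < 1 ∧ ∀ n, LocStencil₂ (rdiv ∘ T (n+1) − rdiv ∘ T n) (c·ϑ^n) δ` —
geometric, EVERY level: the right-leg DRIFT letter row up to sign (FILE 5).  The four hypotheses are DISPLAYED, not discharged. -/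
theorem locStencil₂_rdiv_towerDiff_of_window_slaved_comb {r : Fin (d + 1) → ℕ} (hr : r ∈ box (d + 1) Lc) (c : ℕ → ℝ)
    {T F : ℕ → (Fin (d + 1) → (Fin (d + 1) → ℤ) → Fin (d + 1) → (Fin (d + 1) → ℤ) → MKer (d + 1) (Fib d))}
    (hT0 : ∃ B : ℝ, ∀ κ u κ' u' x z a b, |T 0 κ u κ' u' x z a b| ≤ B) (hF : ∀ m, ∃ B : ℝ, ∀ κ u κ' u' x z a b, |F m κ u κ' u' x z a b| ≤ B)
    (hrec : ∀ m, T (m + 1) = lin4 (c m) (unitK (sfStep Lc m) (smStep d Lc m) (coDressKBmAt (toSite r) Lc (KInvStep (d := d) Lc m))) Lc (T m) + F m)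
    (P : (Fin (d + 1) → (Fin (d + 1) → ℤ) → Fin (d + 1) → (Fin (d + 1) → ℤ) → MKer (d + 1) (Fib d)) → Prop)
    (hP0 : P ((fun κ u κ' u' => rdiv (T 1 κ u κ' u')) - fun κ u κ' u' => rdiv (T 0 κ u κ' u')))
    (hPF : ∀ m, P ((legStepB (fun m => -(c m * ((Lc : ℝ) ^ (d + 1))⁻¹)) (fun m => unitK (sfStep Lc m) (smStep d Lc m) (coDressKBmAt (toSite r) Lc (KInvStep (d := d) Lc m))) Lc (m + 1) (fun κ u κ' u' => rdiv (T m κ u κ' u'))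
        - legStepB (fun m => -(c m * ((Lc : ℝ) ^ (d + 1))⁻¹)) (fun m => unitK (sfStep Lc m) (smStep d Lc m) (coDressKBmAt (toSite r) Lc (KInvStep (d := d) Lc m))) Lc m (fun κ u κ' u' => rdiv (T m κ u κ' u')))
      + ((fun κ u κ' u' => rdiv (F (m + 1) κ u κ' u')) - fun κ u κ' u' => rdiv (F m κ u κ' u'))))
    (hPadd : ∀ X Y, P X → P Y → P (X + Y))
    (hPA : ∀ j (W : (Fin (d + 1) → (Fin (d + 1) → ℤ) → Fin (d + 1) → (Fin (d + 1) → ℤ) → MKer (d + 1) (Fib d))), P W →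
      (∃ B : ℝ, ∀ κ u κ' u' x z a b, |W κ u κ' u' x z a b| ≤ B) → P (legStepB (fun m => -(c m * ((Lc : ℝ) ^ (d + 1))⁻¹)) (fun m => unitK (sfStep Lc m) (smStep d Lc m) (coDressKBmAt (toSite r) Lc (KInvStep (d := d) Lc m))) Lc j W))
    {GoodL : (Fin (d + 1) → (Fin (d + 1) → ℤ) → Fin (d + 1) → (Fin (d + 1) → ℤ) → MKer (d + 1) (Fib d)) → ℝ → Prop} (δ : ℝ)
    {k₀ : ℕ} (hk : 0 < k₀) {θ Cg s M σ μ : ℝ} (hθ0 : 0 ≤ θ) (hθ1 : θ < 1) (hCg : 0 ≤ Cg) (hs : 0 ≤ s) (hM : 0 ≤ M) (hσ : 0 ≤ σ)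
    (hμ0 : 0 ≤ μ) (hμ1 : μ < 1)
    (H1 : ∀ n (W : (Fin (d + 1) → (Fin (d + 1) → ℤ) → Fin (d + 1) → (Fin (d + 1) → ℤ) → MKer (d + 1) (Fib d))) (C g : ℝ), P W →
      (∃ B : ℝ, ∀ κ u κ' u' x z a b, |W κ u κ' u' x z a b| ≤ B) → LocStencil₂ W C δ → GoodL W g →
        LocStencil₂ (legChain (fun m => -(c m * ((Lc : ℝ) ^ (d + 1))⁻¹)) (fun m => unitK (sfStep Lc m) (smStep d Lc m) (coDressKBmAt (toSite r) Lc (KInvStep (d := d) Lc m))) Lc n k₀ (fun κ u κ' u' => bsumPow Lc k₀ (W κ u κ' u'))) (θ * C + Cg * g) δ)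
    (H2 : ∀ n, LocStencil₂ (∑ m ∈ Finset.range k₀, transport (legStepB (fun m => -(c m * ((Lc : ℝ) ^ (d + 1))⁻¹)) (fun m => unitK (sfStep Lc m) (smStep d Lc m) (coDressKBmAt (toSite r) Lc (KInvStep (d := d) Lc m))) Lc) (n + m + 2) (k₀ - 1 - m)
      ((legStepB (fun m => -(c m * ((Lc : ℝ) ^ (d + 1))⁻¹)) (fun m => unitK (sfStep Lc m) (smStep d Lc m) (coDressKBmAt (toSite r) Lc (KInvStep (d := d) Lc m))) Lc (n + m + 1) (fun κ u κ' u' => rdiv (T (n + m) κ u κ' u'))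
          - legStepB (fun m => -(c m * ((Lc : ℝ) ^ (d + 1))⁻¹)) (fun m => unitK (sfStep Lc m) (smStep d Lc m) (coDressKBmAt (toSite r) Lc (KInvStep (d := d) Lc m))) Lc (n + m) (fun κ u κ' u' => rdiv (T (n + m) κ u κ' u')))
        + ((fun κ u κ' u' => rdiv (F (n + m + 1) κ u κ' u')) - fun κ u κ' u' => rdiv (F (n + m) κ u κ' u')))) (s * μ ^ n) δ)
    (H0 : ∀ i, i < k₀ → LocStencil₂ ((fun κ u κ' u' => rdiv (T (i + 1) κ u κ' u')) - fun κ u κ' u' => rdiv (T i κ u κ' u')) M δ)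
    (H3 : ∀ n, GoodL ((fun κ u κ' u' => rdiv (T (n + 1) κ u κ' u')) - fun κ u κ' u' => rdiv (T n κ u κ' u')) (σ * μ ^ n)) :
    ∃ c ϑ : ℝ, 0 ≤ c ∧ 0 < ϑ ∧ ϑ < 1 ∧
      ∀ n, LocStencil₂ ((fun κ u κ' u' => rdiv (T (n + 1) κ u κ' u')) - fun κ u κ' u' => rdiv (T n κ u κ' u')) (c * ϑ ^ n) δ :=
  good_rdiv_towerDiff_of_window_slaved_comb (r := fun _ => r) (fun _ => hr) c hT0 hF hrec P hP0 hPF hPadd hPA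
    (Good := fun X C => LocStencil₂ X C δ) (GoodL := GoodL)
    (fun _ _ _ _ hX hY => locStencil₂_add hX hY) (fun _ _ _ hCC hX => locStencil₂_mono hX hCC)
    hk hθ0 hθ1 hCg hs hM hσ hμ0 hμ1 H1 H2 H0 H3

end Comb

end Summit.QuantumFields.BalabanUV.Beta.GAN24.LegTowerSlavedDriftRows
end
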